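import Summits.QuantumFields.YangMills.Theorems.SwapVirialDeficitBlowUpGnomonicFollowerHessianAngle
import Summits.QuantumFields.YangMills.Theorems.SwapVirialDeficitSectorLaplaceDefs
import HarnessLib

/-!
# Route `SwapVirialDeficit` (YangMills): THE FIBRE HESSIAN FORM `Q_{a,ε,p}` IS LIPSCHITZ IN THE HUB ANGLE, UNIFORMLY DOWN TO THE APEX
# (cell ym-idea-1, skeleton ➎; brick of w2 g60's memo3 §5 for `stub_core_tip` — the full-fibre twin of ✓`abs_gnoFolHessianForm_sub_le_angle`, input of the first-order
# soft-pair ceiling `Q_θ(v_soft) ≤ C L⁴|θ|‖v‖²`; free-hands support of ⟨stmt-QuantumFields-24197⟩ `SwapVirialDeficit.SwapGluedStiffness`)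

* `fibQ_angUnit_eq_iteratedFDeriv` — `Q_{angUnit θ,ε,p}(y) = D²Φ(θ, gnoBase p)[(0, gnoFibreEmb y)]²`, `Φ(q) = gnoDeficitAng q.1 ε q.2` (`sin θ ≥ 0`);
* ★★ `abs_fibQ_angUnit_sub_le` — `|Q_{angUnit θ,ε,p}(y) − Q_{angUnit θ′,ε,p}(y)| ≤ 122689728·L⁴·|θ − θ′|·‖y‖²` (✓`abs_hessianForm_sub_le_of_cubes` on the joint angle function
  with the cube ✓`gnoDeficitAng_third_bound_norm`): the transversal fibre Hessian at the flat base point moves Lipschitz-continuously in the hub angle THROUGH `θ = 0`.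
  Since `angUnit 0 = 1` is the apex, `Q_{1,ε,p}(v) = 0` on the apex-soft directions gives `Q_{angUnit θ}(v) ≤ 122689728L⁴|θ|‖v‖²` there (memo3 §5, next file).

HONEST LABEL: calculus on landed jets; `stub_core_tip` and the other stubs, ⟨24197⟩ ∕ ⟨24194⟩ OPEN; own crux ⟨22884⟩ `LargeFieldMassRefinementTail` OPEN (blocked-on ⟨19935⟩); the
Yang–Mills mass gap is NOT proved; no summit is proved by a line.  THEOREMS ONLY (0 `def`, 0 `sorry`), standard axioms.  Width seat ym-line-sfw-p2-w2 g60 (cell ym-idea-1,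
free hands), `--supports stmt-QuantumFields-24197`.  References: [cite: Luscher1983, §2]; [folklore].
-/

set_option autoImplicit false

noncomputable section

open Quaternion Set
open scoped Quaternion InnerProductSpace
open Literature.MathematicalPhysics.QuantumLattice
open Literature.MathematicalPhysics.QuantumFieldTheory hiding SU2

namespace Summit.QuantumFields.YangMills.Theorems.SwapVirialDeficit.BlowUpRing

open Summit.QuantumFields.YangMills.Theorems.FemtoTransferGap
open Summit.QuantumFields.YangMills.Theorems.FemtoTransferGap.TT
open Summit.QuantumFields.YangMills.Theorems.SwapVirialDeficit.SectorLaplace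
open Summit.QuantumFields.YangMills.Theorems.SwapVirialDeficit.Gnomonic (contDiff_gnoDeficit contDiff_gnoDeficitAng gnoDeficitAng_third_bound_norm)
open Summit.QuantumFields.YangMills.Theorems.QuantitativeLaplace (abs_hessianForm_sub_le_of_cubes iteratedFDeriv_fibre_apply)

variable {L : ℕ} [NeZero L]

omit [NeZero L] in
/-- `angUnit 0 = 1` (the apex). [folklore] -/
theorem angUnit_zero : angUnit 0 = (1 : ℍ) := by
  ext <;> simp [angUnit]

/-- Each coordinate of a fibre vector is bounded by its Euclidean norm. [folklore] -/
theorem abs_apply_le_norm_gnoFibre (y : GnoFibre L) (i : GnoFibreIdx L) : |y i| ≤ ‖y‖ := by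
  have h : ‖y i‖ ≤ ‖y‖ := PiLp.norm_apply_le y i
  rwa [Real.norm_eq_abs] at h

/-- The chart direction of a fibre vector is no longer than the vector: `‖gnoFibreEmb y‖ ≤ ‖y‖` (sup norm of coordinates vs Euclidean norm). [folklore] -/
theorem norm_gnoFibreEmb_le (y : GnoFibre L) : ‖gnoFibreEmb y‖ ≤ ‖y‖ := by
  have h0 : 0 ≤ ‖y‖ := norm_nonneg y
  have hc := abs_apply_le_norm_gnoFibre y
  have hv3 : ∀ v : Fin 3 → ℝ, (∀ k, |v k| ≤ ‖y‖) → ‖v‖ ≤ ‖y‖ := fun v hv =>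
    (pi_norm_le_iff_of_nonneg h0).2 fun k => by rw [Real.norm_eq_abs]; exact hv k
  rw [gnoFibreEmb_apply]
  refine max_le (max_le ?_ ?_) (max_le ?_ ?_)
  · refine hv3 _ fun k => ?_
    fin_cases k
    · simp [h0]
    · exact hc _
    · exact hc _
  · refine hv3 _ fun k => ?_
    fin_cases k
    · simp [h0]
    · exact hc _
    · exact hc _
  · exact hv3 _ fun k => hc _
  · exact (pi_norm_le_iff_of_nonneg h0).2 fun f => hv3 _ fun k => hc _

/-- The fibre form at the hub `angUnit θ` (`sin θ ≥ 0`) on the joint angle function: `Q_{angUnit θ,ε,p}(y) = D²Φ(θ, gnoBase p)[(0, gnoFibreEmb y)]²`. [folklore] -/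
theorem fibQ_angUnit_eq_iteratedFDeriv {θ : ℝ} (hθ : 0 ≤ Real.sin θ) (ε : GnoSign L) (p : ℝ × ℝ) (y : GnoFibre L) :
    fibQ (angUnit θ) ε p y =
      iteratedFDeriv ℝ 2 (fun q : ℝ × GnoCoord L => gnoDeficitAng z₀ (fun _ => 1) q.1 ε q.2) (θ, gnoBase p.1 p.2) (fun _ => ((0 : ℝ), gnoFibreEmb y)) := by
  have hline := Literature.Analysis.Calculus.iteratedDeriv_lineRestriction (n := 2) (contDiff_gnoDeficit (n := 2) z₀ (fun _ => 1) (angUnit_ne_zero θ) ε)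
    (gnoBase p.1 p.2) (gnoFibreEmb y) 0
  rw [zero_smul, add_zero] at hline
  unfold fibQ
  rw [hline]
  have e : gnoDeficit z₀ (fun _ => (1 : SU2)) (angUnit θ) ε = fun η' => (fun q : ℝ × GnoCoord L => gnoDeficitAng z₀ (fun _ => 1) q.1 ε q.2) (θ, η') :=
    funext fun η' => gnoDeficit_angUnit z₀ (fun _ => 1) hθ ε η'
  have h2 : (2 : WithTop ℕ∞) ≤ ((2 : ℕ∞) : WithTop ℕ∞) := le_rfl
  rw [e, iteratedFDeriv_fibre_apply (contDiff_gnoDeficitAng (n := 2) z₀ (fun _ => 1) ε) h2 θ (gnoBase p.1 p.2)]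

/-- ★★ **THE FIBRE HESSIAN FORM IS LIPSCHITZ IN THE HUB ANGLE, THROUGH THE APEX**: for `θ, θ′` with `sin ≥ 0`, every `ε`, base point `p` and fibre vector `y`,
`|Q_{angUnit θ,ε,p}(y) − Q_{angUnit θ′,ε,p}(y)| ≤ 122689728·L⁴·|θ − θ′|·‖y‖²`. [cite: Luscher1983, §2] -/
theorem abs_fibQ_angUnit_sub_le {θ θ' : ℝ} (hθ : 0 ≤ Real.sin θ) (hθ' : 0 ≤ Real.sin θ') (ε : GnoSign L) (p : ℝ × ℝ) (y : GnoFibre L) :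
    |fibQ (angUnit θ) ε p y - fibQ (angUnit θ') ε p y| ≤ 122689728 * (L : ℝ) ^ 4 * |θ - θ'| * ‖y‖ ^ 2 := by
  rw [fibQ_angUnit_eq_iteratedFDeriv hθ ε p y, fibQ_angUnit_eq_iteratedFDeriv hθ' ε p y]
  have h := abs_hessianForm_sub_le_of_cubes (contDiff_gnoDeficitAng (n := 3) z₀ (fun _ => 1) ε) convex_univ (A₃ := 40896576 * (L : ℝ) ^ 4) (by positivity)
    (fun q _ w => gnoDeficitAng_third_bound_norm z₀ (fun _ => 1) ε q w) (mem_univ ((θ, gnoBase p.1 p.2) : ℝ × GnoCoord L))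
    (mem_univ ((θ', gnoBase p.1 p.2) : ℝ × GnoCoord L)) ((0 : ℝ), gnoFibreEmb y)
  refine h.trans ?_
  have hd : ‖((θ, gnoBase p.1 p.2) : ℝ × GnoCoord L) - (θ', gnoBase p.1 p.2)‖ = |θ - θ'| := by
    rw [Prod.mk_sub_mk, sub_self, Prod.norm_def, norm_zero, Real.norm_eq_abs, max_eq_left (abs_nonneg _)]
  have hv : ‖(((0 : ℝ), gnoFibreEmb y) : ℝ × GnoCoord L)‖ ≤ ‖y‖ := by
    rw [Prod.norm_def, norm_zero, max_eq_right (norm_nonneg _)]; exact norm_gnoFibreEmb_le y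
  rw [hd]
  have hT : ‖(((0 : ℝ), gnoFibreEmb y) : ℝ × GnoCoord L)‖ ^ 2 ≤ ‖y‖ ^ 2 := pow_le_pow_left₀ (norm_nonneg _) hv 2
  have hc : 0 ≤ 3 * (40896576 * (L : ℝ) ^ 4) * |θ - θ'| := by positivity
  calc 3 * (40896576 * (L : ℝ) ^ 4) * |θ - θ'| * ‖(((0 : ℝ), gnoFibreEmb y) : ℝ × GnoCoord L)‖ ^ 2 ≤ 3 * (40896576 * (L : ℝ) ^ 4) * |θ - θ'| * ‖y‖ ^ 2 :=
        mul_le_mul_of_nonneg_left hT hc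
    _ = 122689728 * (L : ℝ) ^ 4 * |θ - θ'| * ‖y‖ ^ 2 := by ring

/-- ★ **AT THE APEX**: `angUnit 0 = 1`, so for every `θ` with `sin θ ≥ 0`: `Q_{angUnit θ,ε,p}(y) ≤ Q_{1,ε,p}(y) + 122689728·L⁴·|θ|·‖y‖²` — the first-order soft-pair
ceiling once `Q_{1,ε,p}(v) = 0` on the apex-soft directions (memo3 §5). [folklore] -/
theorem fibQ_angUnit_le_apex_add {θ : ℝ} (hθ : 0 ≤ Real.sin θ) (ε : GnoSign L) (p : ℝ × ℝ) (y : GnoFibre L) :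
    fibQ (angUnit θ) ε p y ≤ fibQ (1 : ℍ) ε p y + 122689728 * (L : ℝ) ^ 4 * |θ| * ‖y‖ ^ 2 := by
  have h0 : 0 ≤ Real.sin 0 := by rw [Real.sin_zero]
  have h := abs_fibQ_angUnit_sub_le hθ h0 ε p y
  rw [sub_zero, angUnit_zero] at h
  have := (abs_le.1 h).2
  linarith

end Summit.QuantumFields.YangMills.Theorems.SwapVirialDeficit.BlowUpRing

end
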